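import Summits.Ventures.CertifiedManyBodySolver.Downfold.EmeryVanHoveBi2212Cq
import Summits.Ventures.CertifiedManyBodySolver.Downfold.EmeryVanHoveLa08Sr02NiO2
import Summits.Ventures.CertifiedManyBodySolver.Downfold.EmeryVanHoveLa438in
import Summits.Ventures.CertifiedManyBodySolver.Downfold.EmeryVanHoveLa438out
import Summits.Ventures.CertifiedManyBodySolver.Downfold.EmeryVanHovePr08Sr02NiO2
import Summits.Ventures.CertifiedManyBodySolver.Downfold.EmeryVanHovePr08Sr02NiO2P12
import Summits.Ventures.CertifiedManyBodySolver.Downfold.EmeryVanHovePr438in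
import Summits.Ventures.CertifiedManyBodySolver.Downfold.EmeryVanHovePr438out
import Summits.Ventures.CertifiedManyBodySolver.Downfold.EmeryVanHoveTl2212
import Summits.Ventures.CertifiedManyBodySolver.Downfold.EmeryVanHoveYBCO6
import Summits.Ventures.CertifiedManyBodySolver.Downfold.EmeryVanHoveYBCO65Plane
import Summits.Ventures.CertifiedManyBodySolver.Downfold.EmeryVanHoveSides
import HarnessLib

/-!
# Which side of the van Hove crossing? — part B (batch-2 boxes): the Sr-doped infinite-layer NICKELATES and the T′ R₄Ni₃O₈ planes sit
# BEYOND the σ crossing at their own hole counts, the cuprate planes (YBCO6, YBCO6.5, Tl-2212, Bi-2212 charged-cell rows) BEFORE it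

Venture CertifiedManyBodySolver, cell `pub/hubbard-downfold` (stage S1), seat hubbard-downfold-mod-4 (technique B); namespace
`Summit.Ventures.CertifiedManyBodySolver.Downfold.Emery`. Everything PROVED (`EmeryVanHoveSides.vhEnergy_lt_of_filling` / `lt_vhEnergy_of_filling` on the landed
batch-2 windows). WHAT THIS IS NOT: a statement about any material (SCREENING-GRADE boxes; the nickelate one-body rows are R-al-widened class-proxy rows); `U = 0`
kinematics of the σ d–p model per plane (the infinite-layer nickelates are k_z-dispersive, self-doped materials — the σ plane statement is one ingredient); no phase word.

READING (certified dichotomy of the typed one-body rows): every CUPRATE plane box of the census has its σ Fermi level ABOVE the saddle point at its own hole count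
(x ≤ 0.2 < x_VH), whereas La₀.₈Sr₀.₂NiO₂ (n_H = 1.238), Pr₀.₈Sr₀.₂NiO₂ (1.23, @0 and @12 GPa) and the R₄Ni₃O₈ planes (n_H = 4/3) have x = n_H − 1 ABOVE their whole
x_VH window (≤ 0.215): in the σ model these nickelate planes are PAST the van Hove crossing (saddle point above E_F… in hole language: more holes than the
Lifshitz count). Sources: [HybertsenSchluterChristensen1989, Eq. (1)]; [AndersenEtAl1995, §6].
-/

noncomputable section

namespace Summit.Ventures.CertifiedManyBodySolver.Downfold.Emery

open Real Set
open Summit.Ventures.CertifiedManyBodySolver.Downfold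

/-- **`emeryBoxYBCO6K26Src`** (n_H ∈ [1, 1], x_VH ≥ 0.2139 > 0): at the box's own hole count the σ Fermi level lies ABOVE the
saddle point at every member (hole-like side). [cite: HybertsenSchluterChristensen1989, Eq. (1) (three-band d–p model)] -/
theorem emeryBoxYBCO6K26Src_fermi_above_vh :
    HoldsOn (fun p : EmeryCoord → ℝ => ∀ ε : ℝ,
      abFilling (p .DeltaPd) (p .tpd) (p .tpp) (p .tppP) ε = (2 - p .nHoles) / 2 →
      vhEnergy (p .DeltaPd) (p .tpd) (p .tppP) < ε) emeryBoxYBCO6K26Src := by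
  intro p hp ε hf
  obtain ⟨hΔ, ha, hb, hc⟩ := emeryBoxYBCO6K26Src_oneBodyRows hp
  have hn := (Entry.mem_ofEnds_iff _ _ _ _ _).1 (hp .nHoles ybco6K26Emery_nH rfl)
  push_cast at hn
  have hx := (yBCO6Box_xVH hΔ ha hb hc).2.2.2.1
  exact vhEnergy_lt_of_filling (by linarith [hn.2]) hf

/-- **`emeryBoxLa08Sr02NiO2YK26Src`** (n_H ∈ [1.238, 1.238], x_VH ≤ 0.2065 < 0.238): at the box's own hole count the σ Fermi level lies BELOW the
saddle point at every member — BEYOND the van Hove crossing. [cite: HybertsenSchluterChristensen1989, Eq. (1) (three-band d–p model)] -/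
theorem emeryBoxLa08Sr02NiO2YK26Src_fermi_below_vh :
    HoldsOn (fun p : EmeryCoord → ℝ => ∀ ε : ℝ,
      abFilling (p .DeltaPd) (p .tpd) (p .tpp) (p .tppP) ε = (2 - p .nHoles) / 2 →
      ε < vhEnergy (p .DeltaPd) (p .tpd) (p .tppP)) emeryBoxLa08Sr02NiO2YK26Src := by
  intro p hp ε hf
  obtain ⟨hΔ, ha, hb, hc⟩ := emeryBoxLa08Sr02NiO2YK26Src_oneBodyRows hp
  have hn := (Entry.mem_ofEnds_iff _ _ _ _ _).1 (hp .nHoles la08Sr02NiO2YK26Emery_nH rfl)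
  push_cast at hn
  have hx := (la08Sr02NiO2Box_xVH hΔ ha hb hc).2.2.2.2
  exact lt_vhEnergy_of_filling (by linarith [hn.1]) hf

/-- **`emeryBoxPr08Sr02NiO2YK26Src`** (n_H ∈ [1.23, 1.23], x_VH ≤ 0.2052 < 0.23): at the box's own hole count the σ Fermi level lies BELOW the
saddle point at every member — BEYOND the van Hove crossing. [cite: HybertsenSchluterChristensen1989, Eq. (1) (three-band d–p model)] -/
theorem emeryBoxPr08Sr02NiO2YK26Src_fermi_below_vh :
    HoldsOn (fun p : EmeryCoord → ℝ => ∀ ε : ℝ,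
      abFilling (p .DeltaPd) (p .tpd) (p .tpp) (p .tppP) ε = (2 - p .nHoles) / 2 →
      ε < vhEnergy (p .DeltaPd) (p .tpd) (p .tppP)) emeryBoxPr08Sr02NiO2YK26Src := by
  intro p hp ε hf
  obtain ⟨hΔ, ha, hb, hc⟩ := emeryBoxPr08Sr02NiO2YK26Src_oneBodyRows hp
  have hn := (Entry.mem_ofEnds_iff _ _ _ _ _).1 (hp .nHoles pr08Sr02NiO2YK26Emery_nH rfl)
  push_cast at hn
  have hx := (pr08Sr02NiO2Box_xVH hΔ ha hb hc).2.2.2.2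
  exact lt_vhEnergy_of_filling (by linarith [hn.1]) hf

/-- **`emeryBoxPr08Sr02NiO2P12YK26Src`** (n_H ∈ [1.23, 1.23], x_VH ≤ 0.2009 < 0.23): at the box's own hole count the σ Fermi level lies BELOW the
saddle point at every member — BEYOND the van Hove crossing. [cite: HybertsenSchluterChristensen1989, Eq. (1) (three-band d–p model)] -/
theorem emeryBoxPr08Sr02NiO2P12YK26Src_fermi_below_vh :
    HoldsOn (fun p : EmeryCoord → ℝ => ∀ ε : ℝ,
      abFilling (p .DeltaPd) (p .tpd) (p .tpp) (p .tppP) ε = (2 - p .nHoles) / 2 →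
      ε < vhEnergy (p .DeltaPd) (p .tpd) (p .tppP)) emeryBoxPr08Sr02NiO2P12YK26Src := by
  intro p hp ε hf
  obtain ⟨hΔ, ha, hb, hc⟩ := emeryBoxPr08Sr02NiO2P12YK26Src_oneBodyRows hp
  have hn := (Entry.mem_ofEnds_iff _ _ _ _ _).1 (hp .nHoles pr08Sr02NiO2P12YK26Emery_nH rfl)
  push_cast at hn
  have hx := (pr08Sr02NiO2P12Box_xVH hΔ ha hb hc).2.2.2.2
  exact lt_vhEnergy_of_filling (by linarith [hn.1]) hf

/-- **`emeryBoxTl2212K26Src`** (n_H ∈ [1.16, 1.2], x_VH ≥ 0.2485 > 0.2): at the box's own hole count the σ Fermi level lies ABOVE the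
saddle point at every member (hole-like side). [cite: HybertsenSchluterChristensen1989, Eq. (1) (three-band d–p model)] -/
theorem emeryBoxTl2212K26Src_fermi_above_vh :
    HoldsOn (fun p : EmeryCoord → ℝ => ∀ ε : ℝ,
      abFilling (p .DeltaPd) (p .tpd) (p .tpp) (p .tppP) ε = (2 - p .nHoles) / 2 →
      vhEnergy (p .DeltaPd) (p .tpd) (p .tppP) < ε) emeryBoxTl2212K26Src := by
  intro p hp ε hf
  obtain ⟨hΔ, ha, hb, hc⟩ := emeryBoxTl2212K26Src_oneBodyRows hp
  have hn := (Entry.mem_ofEnds_iff _ _ _ _ _).1 (hp .nHoles tl2212K26Emery_nH rfl)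
  push_cast at hn
  have hx := (tl2212Box_xVH hΔ ha hb hc).2.2.2.1
  exact vhEnergy_lt_of_filling (by linarith [hn.2]) hf

/-- **`emeryBoxBi2212CqK26Src`** (n_H ∈ [1.16, 1.2], x_VH ≥ 0.2224 > 0.2): at the box's own hole count the σ Fermi level lies ABOVE the
saddle point at every member (hole-like side). [cite: HybertsenSchluterChristensen1989, Eq. (1) (three-band d–p model)] -/
theorem emeryBoxBi2212CqK26Src_fermi_above_vh :
    HoldsOn (fun p : EmeryCoord → ℝ => ∀ ε : ℝ,
      abFilling (p .DeltaPd) (p .tpd) (p .tpp) (p .tppP) ε = (2 - p .nHoles) / 2 →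
      vhEnergy (p .DeltaPd) (p .tpd) (p .tppP) < ε) emeryBoxBi2212CqK26Src := by
  intro p hp ε hf
  obtain ⟨hΔ, ha, hb, hc⟩ := emeryBoxBi2212CqK26Src_oneBodyRows hp
  have hn := (Entry.mem_ofEnds_iff _ _ _ _ _).1 (hp .nHoles bi2212CqK26Emery_nH rfl)
  push_cast at hn
  have hx := (bi2212CqBox_xVH hΔ ha hb hc).2.2.2.1
  exact vhEnergy_lt_of_filling (by linarith [hn.2]) hf

/-- **`emeryBoxYBCO65planeY6K26Src`** (n_H ∈ [1.077, 1.12], x_VH ≥ 0.2284 > 0.12): at the box's own hole count the σ Fermi level lies ABOVE the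
saddle point at every member (hole-like side). [cite: HybertsenSchluterChristensen1989, Eq. (1) (three-band d–p model)] -/
theorem emeryBoxYBCO65planeY6K26Src_fermi_above_vh :
    HoldsOn (fun p : EmeryCoord → ℝ => ∀ ε : ℝ,
      abFilling (p .DeltaPd) (p .tpd) (p .tpp) (p .tppP) ε = (2 - p .nHoles) / 2 →
      vhEnergy (p .DeltaPd) (p .tpd) (p .tppP) < ε) emeryBoxYBCO65planeY6K26Src := by
  intro p hp ε hf
  obtain ⟨hΔ, ha, hb, hc⟩ := emeryBoxYBCO65planeY6K26Src_oneBodyRows hp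
  have hn := (Entry.mem_ofEnds_iff _ _ _ _ _).1 (hp .nHoles ybco65planeY6K26Emery_nH rfl)
  push_cast at hn
  have hx := (yBCO65PlaneBox_xVH hΔ ha hb hc).2.2.2.1
  exact vhEnergy_lt_of_filling (by linarith [hn.2]) hf

/-- **`emeryBoxPr438outYK26Src`** (n_H ∈ [1.33333, 1.33333], x_VH ≤ 0.2150 < 0.3333): at the box's own hole count the σ Fermi level lies BELOW the
saddle point at every member — BEYOND the van Hove crossing. [cite: HybertsenSchluterChristensen1989, Eq. (1) (three-band d–p model)] -/
theorem emeryBoxPr438outYK26Src_fermi_below_vh :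
    HoldsOn (fun p : EmeryCoord → ℝ => ∀ ε : ℝ,
      abFilling (p .DeltaPd) (p .tpd) (p .tpp) (p .tppP) ε = (2 - p .nHoles) / 2 →
      ε < vhEnergy (p .DeltaPd) (p .tpd) (p .tppP)) emeryBoxPr438outYK26Src := by
  intro p hp ε hf
  obtain ⟨hΔ, ha, hb, hc⟩ := emeryBoxPr438outYK26Src_oneBodyRows hp
  have hn := (Entry.mem_ofEnds_iff _ _ _ _ _).1 (hp .nHoles pr438outYK26Emery_nH rfl)
  push_cast at hn
  have hx := (pr438outBox_xVH hΔ ha hb hc).2.2.2.2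
  exact lt_vhEnergy_of_filling (by linarith [hn.1]) hf

/-- **`emeryBoxPr438inYK26Src`** (n_H ∈ [1.33333, 1.33333], x_VH ≤ 0.2150 < 0.3333): at the box's own hole count the σ Fermi level lies BELOW the
saddle point at every member — BEYOND the van Hove crossing. [cite: HybertsenSchluterChristensen1989, Eq. (1) (three-band d–p model)] -/
theorem emeryBoxPr438inYK26Src_fermi_below_vh :
    HoldsOn (fun p : EmeryCoord → ℝ => ∀ ε : ℝ,
      abFilling (p .DeltaPd) (p .tpd) (p .tpp) (p .tppP) ε = (2 - p .nHoles) / 2 →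
      ε < vhEnergy (p .DeltaPd) (p .tpd) (p .tppP)) emeryBoxPr438inYK26Src := by
  intro p hp ε hf
  obtain ⟨hΔ, ha, hb, hc⟩ := emeryBoxPr438inYK26Src_oneBodyRows hp
  have hn := (Entry.mem_ofEnds_iff _ _ _ _ _).1 (hp .nHoles pr438inYK26Emery_nH rfl)
  push_cast at hn
  have hx := (pr438inBox_xVH hΔ ha hb hc).2.2.2.2
  exact lt_vhEnergy_of_filling (by linarith [hn.1]) hf

/-- **`emeryBoxLa438outYK26Src`** (n_H ∈ [1.33333, 1.33333], x_VH ≤ 0.2136 < 0.3333): at the box's own hole count the σ Fermi level lies BELOW the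
saddle point at every member — BEYOND the van Hove crossing. [cite: HybertsenSchluterChristensen1989, Eq. (1) (three-band d–p model)] -/
theorem emeryBoxLa438outYK26Src_fermi_below_vh :
    HoldsOn (fun p : EmeryCoord → ℝ => ∀ ε : ℝ,
      abFilling (p .DeltaPd) (p .tpd) (p .tpp) (p .tppP) ε = (2 - p .nHoles) / 2 →
      ε < vhEnergy (p .DeltaPd) (p .tpd) (p .tppP)) emeryBoxLa438outYK26Src := by
  intro p hp ε hf
  obtain ⟨hΔ, ha, hb, hc⟩ := emeryBoxLa438outYK26Src_oneBodyRows hp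
  have hn := (Entry.mem_ofEnds_iff _ _ _ _ _).1 (hp .nHoles la438outYK26Emery_nH rfl)
  push_cast at hn
  have hx := (la438outBox_xVH hΔ ha hb hc).2.2.2.2
  exact lt_vhEnergy_of_filling (by linarith [hn.1]) hf

/-- **`emeryBoxLa438inYK26Src`** (n_H ∈ [1.33333, 1.33333], x_VH ≤ 0.2136 < 0.3333): at the box's own hole count the σ Fermi level lies BELOW the
saddle point at every member — BEYOND the van Hove crossing. [cite: HybertsenSchluterChristensen1989, Eq. (1) (three-band d–p model)] -/
theorem emeryBoxLa438inYK26Src_fermi_below_vh :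
    HoldsOn (fun p : EmeryCoord → ℝ => ∀ ε : ℝ,
      abFilling (p .DeltaPd) (p .tpd) (p .tpp) (p .tppP) ε = (2 - p .nHoles) / 2 →
      ε < vhEnergy (p .DeltaPd) (p .tpd) (p .tppP)) emeryBoxLa438inYK26Src := by
  intro p hp ε hf
  obtain ⟨hΔ, ha, hb, hc⟩ := emeryBoxLa438inYK26Src_oneBodyRows hp
  have hn := (Entry.mem_ofEnds_iff _ _ _ _ _).1 (hp .nHoles la438inYK26Emery_nH rfl)
  push_cast at hn
  have hx := (la438inBox_xVH hΔ ha hb hc).2.2.2.2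
  exact lt_vhEnergy_of_filling (by linarith [hn.1]) hf

end Summit.Ventures.CertifiedManyBodySolver.Downfold.Emery
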